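import Mathlib
import HarnessLib
import Summits.Ventures.LatticeQCDFlow.Scoring.MinorisedGreenKubo
import Summits.Ventures.LatticeQCDFlow.Scoring.SplitChainResidualMoves

/-!
# The split-chain resolvent `g = Σ_d (1−ε)^d R^d f` — expected occupation of `f` until the next
# regeneration — is bounded by `C/ε`, satisfies `g = f + (1−ε) R g`, has `ν(g) = π(f)/ε`, and for
# centred `f` SOLVES THE POISSON EQUATION `g − K g = f`

HONEST FRAMING: exact (Metropolis-corrected) sampling algorithms for lattice gauge theory;
figures of merit are autocorrelation/cost numbers at stated couplings and volumes; no
continuum-physics claim.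

Venture `LatticeQCDFlow` (cell pub-lqcd), topic `Scoring`; FANOUT row 8 (`s0-cpn-nemc`, GEN-17).
NEW WORK of the cell, not a published result; no definition is introduced (the resolvent is written
out as the lambda `fun x => ∑' d, (1 − e)^d · (kop R)^[d] f x` in every statement).  Kernel level only
(no path space): `κ` Markov with `κ(x, ·) ≥ ε ν` for an ARBITRARY probability law `ν`, `0 < ε < 1`,
`R = Doeblin.residualKernel κ ν ε hmin` the tree's residual kernel (`κ = ε ν + (1 − ε) R`).  Between
regenerations the split chain moves by `R` and survives each step with probability `1 − ε`
(`Scoring/SplitChainResidualMoves.lean`), so `g(x) = Σ_{d ≥ 0} (1 − ε)^d (R^d f)(x)` is the expected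
`f`-occupation from `x` until the next regeneration.  This file: the series converges absolutely
(`|g| ≤ C/ε`), `g` is measurable, the RESOLVENT IDENTITY `g = f + (1 − ε) · R g` (finite linearity of
`kop R` and dominated convergence), the DOEBLIN SERIES `ν(g) = π(f)/ε` for `π` invariant (the
`n → ∞` limit of `Scoring.invariant_integral_eq_doeblin_series`, i.e. Kac's formula at kernel level),
and hence, for `π`-CENTRED `f`: `K g = ε ν(g) + (1 − ε) R g = g − f`, i.e. `g` SOLVES THE POISSON
EQUATION `g − kop κ g = f` — so by `Scoring/MinorisedGreenKubo.lean` `Σ_t C_f(t) = ⟨f, g⟩_π`.  This is the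
kernel-level half of "tour variance = asymptotic variance" for a general minorising law
(`Scoring/TourVarianceGeneral.lean`).  Printed counterpart NAMED ONLY: the potential-kernel /
fundamental-matrix solution of the Poisson equation for a chain with an atom or a split chain
(Nummelin 1984 §5; Meyn–Tweedie 1993 §17.4; Glynn–Meyn 1996) — nothing is cited as a fact.

## Content (`e = ε.toReal`; `|f| ≤ C` measurable; `g := fun x => ∑' d, (1 − e)^d · (kop R)^[d] f x`)

* `resolvent_term_abs_le`, `resolvent_summable`, **`resolvent_bounded_measurable`** — the terms are
  `≤ C(1 − e)^d`, the series is summable, `g` is measurable with `|g| ≤ C/e`;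
* **`resolvent_eq`** — `g x = f x + (1 − e) · kop R g x`; `resolvent_tail_eq` —
  `∑' d, (1 − e)^{d+1} (kop R)^[d+1] f x = g x − f x`;
* **`doeblin_series_hasSum`** — `HasSum (u ↦ (1 − e)^u ν((kop R)^[u] f)) (π(f)/e)` for `π` invariant;
  **`integral_resolvent_eq`** — `ν(g) = π(f)/e`;
* **`resolvent_poisson`** — for `π(f) = 0`: `g x − kop κ g x = f x`;
  **`greenKubo_hasSum_resolvent`** — `HasSum (t ↦ ∫ f · (kop κ)^[t] f dπ) (∫ f g dπ)`.

NOT CLAIMED: uniqueness of `g` among unbounded solutions; `ε = 1`; any `ε` of a concrete sampler.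
-/

noncomputable section

namespace Summit.Ventures.LatticeQCDFlow.Scoring

open MeasureTheory ProbabilityTheory Filter Literature.Probability.MarkovChains
open scoped ENNReal Topology

variable {Ω : Type*} [MeasurableSpace Ω]

section Resolvent

variable {κ : Kernel Ω Ω} [IsMarkovKernel κ] {ν : Measure Ω} [IsProbabilityMeasure ν] {ε : ℝ≥0∞}
  {hmin : ∀ x {B : Set Ω}, MeasurableSet B → ε * ν B ≤ κ x B}

/-- The resolvent terms are bounded: `|(1 − e)^d (kop R)^[d] f x| ≤ C (1 − e)^d`. -/
theorem resolvent_term_abs_le (hε : ε < 1) {f : Ω → ℝ} (hf : Measurable f) {C : ℝ}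
    (hC : ∀ x, |f x| ≤ C) (d : ℕ) (x : Ω) :
    |(1 - ε.toReal) ^ d * (kop (Doeblin.residualKernel κ ν ε hmin))^[d] f x|
      ≤ C * (1 - ε.toReal) ^ d := by
  haveI := Doeblin.isMarkovKernel_residualKernel (κ := κ) (ν := ν) (hmin := hmin) hε
  obtain ⟨-, hr0, -⟩ := one_sub_toReal_eq_of_lt_one (ε := ε) hε
  obtain ⟨-, hb⟩ := iterate_kop_bounded_measurable (Doeblin.residualKernel κ ν ε hmin) hf hC d
  rw [abs_mul, abs_of_nonneg (pow_nonneg hr0 d), mul_comm]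
  exact mul_le_mul_of_nonneg_right (hb x) (pow_nonneg hr0 d)

/-- The geometric majorant: `HasSum (d ↦ C (1 − e)^d) (C/e)` for `0 < ε < 1`. -/
theorem resolvent_majorant_hasSum (hε0 : 0 < ε) (hε : ε < 1) (C : ℝ) :
    HasSum (fun d : ℕ => C * (1 - ε.toReal) ^ d) (C / ε.toReal) := by
  obtain ⟨-, hl0, he1⟩ := one_sub_toReal_eq_of_lt_one (ε := ε) hε
  have hl1 : 1 - ε.toReal < 1 := by
    have := ENNReal.toReal_pos hε0.ne' (ne_top_of_lt hε); linarith
  have h := (hasSum_geometric_of_lt_one hl0 hl1).mul_left C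
  rwa [sub_sub_cancel, ← div_eq_mul_inv] at h

/-- **The resolvent series is absolutely summable** at every point. -/
theorem resolvent_summable (hε0 : 0 < ε) (hε : ε < 1) {f : Ω → ℝ} (hf : Measurable f) {C : ℝ}
    (hC : ∀ x, |f x| ≤ C) (x : Ω) :
    Summable fun d : ℕ => (1 - ε.toReal) ^ d * (kop (Doeblin.residualKernel κ ν ε hmin))^[d] f x :=
  Summable.of_norm_bounded (resolvent_majorant_hasSum hε0 hε C).summable fun d => by
    rw [Real.norm_eq_abs]; exact resolvent_term_abs_le (κ := κ) (ν := ν) (hmin := hmin) hε hf hC d x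

/-- **The resolvent `g = Σ_d (1 − e)^d R^d f` is measurable and bounded by `C/e`.** -/
theorem resolvent_bounded_measurable (hε0 : 0 < ε) (hε : ε < 1) {f : Ω → ℝ} (hf : Measurable f)
    {C : ℝ} (hC : ∀ x, |f x| ≤ C) :
    Measurable (fun x => ∑' d, (1 - ε.toReal) ^ d
        * (kop (Doeblin.residualKernel κ ν ε hmin))^[d] f x)
    ∧ ∀ x, |∑' d, (1 - ε.toReal) ^ d * (kop (Doeblin.residualKernel κ ν ε hmin))^[d] f x|
      ≤ C / ε.toReal := by
  haveI := Doeblin.isMarkovKernel_residualKernel (κ := κ) (ν := ν) (hmin := hmin) hε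
  have hgeo := resolvent_majorant_hasSum hε0 hε C
  have hterm := fun d x => resolvent_term_abs_le (κ := κ) (ν := ν) (hmin := hmin) hε hf hC d x
  refine ⟨?_, fun x => ?_⟩
  · refine Measurable.tsum (f := fun (d : ℕ) (x : Ω) => (1 - ε.toReal) ^ d
      * (kop (Doeblin.residualKernel κ ν ε hmin))^[d] f x) fun d => ?_
    exact ((iterate_kop_bounded_measurable (Doeblin.residualKernel κ ν ε hmin) hf hC d).1).const_mul _
  · have h1 := tsum_of_norm_bounded hgeo fun d => by rw [Real.norm_eq_abs]; exact hterm d x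
    rwa [Real.norm_eq_abs] at h1

/-- **THE RESOLVENT IDENTITY**: `g x = f x + (1 − e) · (kop R g)(x)` — one residual step, discounted
by the survival probability `1 − ε`, regenerates the series. -/
theorem resolvent_eq (hε0 : 0 < ε) (hε : ε < 1) {f : Ω → ℝ} (hf : Measurable f) {C : ℝ}
    (hC : ∀ x, |f x| ≤ C) (x : Ω) :
    (∑' d, (1 - ε.toReal) ^ d * (kop (Doeblin.residualKernel κ ν ε hmin))^[d] f x)
      = f x + (1 - ε.toReal) * kop (Doeblin.residualKernel κ ν ε hmin)
        (fun y => ∑' d, (1 - ε.toReal) ^ d * (kop (Doeblin.residualKernel κ ν ε hmin))^[d] f y) x := by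
  haveI := Doeblin.isMarkovKernel_residualKernel (κ := κ) (ν := ν) (hmin := hmin) hε
  set Rk := Doeblin.residualKernel κ ν ε hmin with hRk
  have hgeo := resolvent_majorant_hasSum hε0 hε C
  obtain ⟨-, hl0, -⟩ := one_sub_toReal_eq_of_lt_one (ε := ε) hε
  have hterm := fun d y => resolvent_term_abs_le (κ := κ) (ν := ν) (hmin := hmin) hε hf hC d y
  have hsum := fun y => resolvent_summable (κ := κ) (ν := ν) (hmin := hmin) hε0 hε hf hC y
  -- partial sums
  set S : ℕ → Ω → ℝ := fun N y => ∑ d ∈ Finset.range N, (1 - ε.toReal) ^ d * (kop Rk)^[d] f y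
    with hS
  have hSm : ∀ N, Measurable (S N) := fun N =>
    Finset.measurable_sum _ fun d _ => ((iterate_kop_bounded_measurable Rk hf hC d).1).const_mul _
  have hSb : ∀ N y, |S N y| ≤ C / ε.toReal := by
    intro N y
    calc |S N y| ≤ ∑ d ∈ Finset.range N, |(1 - ε.toReal) ^ d * (kop Rk)^[d] f y| :=
          Finset.abs_sum_le_sum_abs _ _
      _ ≤ ∑ d ∈ Finset.range N, C * (1 - ε.toReal) ^ d := Finset.sum_le_sum fun d _ => hterm d y
      _ ≤ C / ε.toReal := sum_le_hasSum _ (fun d _ => mul_nonneg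
          ((abs_nonneg _).trans (hC y)) (pow_nonneg hl0 d)) hgeo
  have hlim : ∀ y, Tendsto (fun N => S N y) atTop
      (𝓝 (∑' d, (1 - ε.toReal) ^ d * (kop Rk)^[d] f y)) := fun y => (hsum y).hasSum.tendsto_sum_nat
  -- the recursion `S (N+1) = f + (1 − e) kop R (S N)`
  have hrec : ∀ N, S (N + 1) x = f x + (1 - ε.toReal) * kop Rk (S N) x := by
    intro N
    have hlin : kop Rk (S N) x = ∑ d ∈ Finset.range N, (1 - ε.toReal) ^ d * (kop Rk)^[d + 1] f x := by
      show ∫ y, (∑ d ∈ Finset.range N, (1 - ε.toReal) ^ d * (kop Rk)^[d] f y) ∂(Rk x) = _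
      rw [integral_finsetSum _ fun d _ => ?_]
      · refine Finset.sum_congr rfl fun d _ => ?_
        rw [integral_const_mul, Function.iterate_succ_apply']
        rfl
      · obtain ⟨hm, hb⟩ := iterate_kop_bounded_measurable Rk hf hC d
        exact (integrable_of_bounded _ hm hb).const_mul _
    rw [hlin, Finset.mul_sum]
    show ∑ d ∈ Finset.range (N + 1), (1 - ε.toReal) ^ d * (kop Rk)^[d] f x = _
    rw [Finset.sum_range_succ']
    simp only [Function.iterate_zero, id_eq, pow_zero, one_mul]
    rw [add_comm]
    congr 1
    exact Finset.sum_congr rfl fun d _ => by rw [pow_succ]; ring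
  -- dominated convergence for `kop R (S N) x`
  have hdct : Tendsto (fun N => kop Rk (S N) x) atTop
      (𝓝 (kop Rk (fun y => ∑' d, (1 - ε.toReal) ^ d * (kop Rk)^[d] f y) x)) := by
    unfold kop
    refine tendsto_integral_of_dominated_convergence (fun _ => C / ε.toReal)
      (fun N => (hSm N).aestronglyMeasurable) (integrable_const _) (fun N => ae_of_all _ fun y => ?_)
      (ae_of_all _ fun y => hlim y)
    rw [Real.norm_eq_abs]
    exact hSb N y
  have hlim1 : Tendsto (fun N => S (N + 1) x) atTop
      (𝓝 (∑' d, (1 - ε.toReal) ^ d * (kop Rk)^[d] f x)) := (hlim x).comp (tendsto_add_atTop_nat 1)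
  have hlim2 : Tendsto (fun N => S (N + 1) x) atTop (𝓝 (f x + (1 - ε.toReal)
      * kop Rk (fun y => ∑' d, (1 - ε.toReal) ^ d * (kop Rk)^[d] f y) x)) := by
    have := (hdct.const_mul (1 - ε.toReal)).const_add (f x)
    exact this.congr fun N => (hrec N).symm
  exact tendsto_nhds_unique hlim1 hlim2

/-- **The tail of the resolvent series**: `∑' d, (1 − e)^{d+1} (kop R)^[d+1] f x = g x − f x`. -/
theorem resolvent_tail_eq (hε0 : 0 < ε) (hε : ε < 1) {f : Ω → ℝ} (hf : Measurable f) {C : ℝ}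
    (hC : ∀ x, |f x| ≤ C) (x : Ω) :
    (∑' d, (1 - ε.toReal) ^ (d + 1) * (kop (Doeblin.residualKernel κ ν ε hmin))^[d + 1] f x)
      = (∑' d, (1 - ε.toReal) ^ d * (kop (Doeblin.residualKernel κ ν ε hmin))^[d] f x) - f x := by
  have h := (resolvent_summable (κ := κ) (ν := ν) (hmin := hmin) hε0 hε hf hC x).sum_add_tsum_nat_add 1
  rw [Finset.sum_range_one, pow_zero, one_mul, Function.iterate_zero, id_eq] at h
  linarith

variable {π : Measure Ω} [IsProbabilityMeasure π]

/-- **THE DOEBLIN SERIES (Kac at kernel level)**: for `π` invariant,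
`HasSum (u ↦ (1 − e)^u · ν((kop R)^[u] f)) (π(f)/e)`. -/
theorem doeblin_series_hasSum (hπ : Kernel.Invariant κ π) (hε0 : 0 < ε) (hε : ε < 1) {f : Ω → ℝ}
    (hf : Measurable f) {C : ℝ} (hC : ∀ x, |f x| ≤ C) :
    HasSum (fun u : ℕ => (1 - ε.toReal) ^ u
        * ∫ y, (kop (Doeblin.residualKernel κ ν ε hmin))^[u] f y ∂ν) ((∫ x, f x ∂π) / ε.toReal) := by
  haveI := Doeblin.isMarkovKernel_residualKernel (κ := κ) (ν := ν) (hmin := hmin) hε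
  obtain ⟨-, hl0, he1⟩ := one_sub_toReal_eq_of_lt_one (ε := ε) hε
  have he0 : 0 < ε.toReal := ENNReal.toReal_pos hε0.ne' (ne_top_of_lt hε)
  have hl1 : 1 - ε.toReal < 1 := by linarith
  have hsum' : Summable fun u : ℕ => (1 - ε.toReal) ^ u
      * ∫ y, (kop (Doeblin.residualKernel κ ν ε hmin))^[u] f y ∂ν := by
    refine Summable.of_norm_bounded ((summable_geometric_of_lt_one hl0 hl1).mul_left C) fun u => ?_
    obtain ⟨-, hb⟩ := iterate_kop_bounded_measurable (Doeblin.residualKernel κ ν ε hmin) hf hC u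
    rw [Real.norm_eq_abs, abs_mul, abs_of_nonneg (pow_nonneg hl0 u), mul_comm]
    refine mul_le_mul_of_nonneg_right ?_ (pow_nonneg hl0 u)
    calc |∫ y, (kop (Doeblin.residualKernel κ ν ε hmin))^[u] f y ∂ν|
        = ‖∫ y, (kop (Doeblin.residualKernel κ ν ε hmin))^[u] f y ∂ν‖ := (Real.norm_eq_abs _).symm
      _ ≤ C * ν.real Set.univ := norm_integral_le_of_norm_le_const (Eventually.of_forall fun y => by
          rw [Real.norm_eq_abs]; exact hb y)
      _ = C := by rw [probReal_univ, mul_one]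
  have hlim : Tendsto (fun n : ℕ => ∑ u ∈ Finset.range n, (1 - ε.toReal) ^ u
      * ∫ y, (kop (Doeblin.residualKernel κ ν ε hmin))^[u] f y ∂ν) atTop
      (𝓝 ((∫ x, f x ∂π) / ε.toReal)) := by
    rw [tendsto_iff_norm_sub_tendsto_zero]
    refine squeeze_zero_norm (a := fun n : ℕ => (1 - ε.toReal) ^ n * (C / ε.toReal))
      (fun n => ?_) ?_
    · have h := doeblin_series_remainder_le (κ := κ) (ν := ν) (hmin := hmin) hπ hε hf hC n
      rw [norm_norm, Real.norm_eq_abs]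
      have heq : (∑ u ∈ Finset.range n, (1 - ε.toReal) ^ u
          * ∫ y, (kop (Doeblin.residualKernel κ ν ε hmin))^[u] f y ∂ν) - (∫ x, f x ∂π) / ε.toReal
          = -((∫ x, f x ∂π - ε.toReal * ∑ u ∈ Finset.range n, (1 - ε.toReal) ^ u
            * ∫ y, (kop (Doeblin.residualKernel κ ν ε hmin))^[u] f y ∂ν) / ε.toReal) := by
        field_simp
        ring
      rw [heq, abs_neg, abs_div, abs_of_pos he0, div_le_iff₀ he0]
      calc _ ≤ (1 - ε.toReal) ^ n * C := h
        _ = (1 - ε.toReal) ^ n * (C / ε.toReal) * ε.toReal := by field_simp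
    · have h0 := (tendsto_pow_atTop_nhds_zero_of_lt_one hl0 hl1).mul_const (C / ε.toReal)
      rwa [zero_mul] at h0
  exact (hsum'.hasSum_iff_tendsto_nat).2 hlim

/-- **`ν(g) = π(f)/e`**: the `ν`-mean of the resolvent is the stationary mean over `ε` (exchange of
`ν` with the absolutely convergent series, then the Doeblin series). -/
theorem integral_resolvent_eq (hπ : Kernel.Invariant κ π) (hε0 : 0 < ε) (hε : ε < 1) {f : Ω → ℝ}
    (hf : Measurable f) {C : ℝ} (hC : ∀ x, |f x| ≤ C) :
    ∫ y, (∑' d, (1 - ε.toReal) ^ d * (kop (Doeblin.residualKernel κ ν ε hmin))^[d] f y) ∂ν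
      = (∫ x, f x ∂π) / ε.toReal := by
  haveI := Doeblin.isMarkovKernel_residualKernel (κ := κ) (ν := ν) (hmin := hmin) hε
  obtain ⟨-, hl0, -⟩ := one_sub_toReal_eq_of_lt_one (ε := ε) hε
  have hterm := fun d y => resolvent_term_abs_le (κ := κ) (ν := ν) (hmin := hmin) hε hf hC d y
  have hint : ∀ d : ℕ, Integrable (fun y => (1 - ε.toReal) ^ d
      * (kop (Doeblin.residualKernel κ ν ε hmin))^[d] f y) ν := fun d => by
    obtain ⟨hm, hb⟩ := iterate_kop_bounded_measurable (Doeblin.residualKernel κ ν ε hmin) hf hC d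
    exact (integrable_of_bounded ν hm hb).const_mul _
  have hnorm : Summable fun d : ℕ => ∫ y, ‖(1 - ε.toReal) ^ d
      * (kop (Doeblin.residualKernel κ ν ε hmin))^[d] f y‖ ∂ν := by
    refine Summable.of_nonneg_of_le (fun d => integral_nonneg fun y => norm_nonneg _) (fun d => ?_)
      (resolvent_majorant_hasSum hε0 hε C).summable
    calc ∫ y, ‖(1 - ε.toReal) ^ d * (kop (Doeblin.residualKernel κ ν ε hmin))^[d] f y‖ ∂ν
        ≤ ∫ y, C * (1 - ε.toReal) ^ d ∂ν := integral_mono (hint d).norm (integrable_const _)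
          fun y => by rw [Real.norm_eq_abs]; exact hterm d y
      _ = C * (1 - ε.toReal) ^ d := by rw [integral_const, probReal_univ, one_smul]
  rw [← integral_tsum_of_summable_integral_norm hint hnorm]
  simp_rw [integral_const_mul]
  exact (doeblin_series_hasSum (κ := κ) (ν := ν) (hmin := hmin) hπ hε0 hε hf hC).tsum_eq

/-- **THE RESOLVENT SOLVES THE POISSON EQUATION**: for `π` invariant, `κ(x, ·) ≥ ε ν`, `0 < ε < 1`,
`|f| ≤ C` measurable with `π(f) = 0`, and `g = Σ_d (1 − e)^d R^d f`:  `g x − (kop κ g)(x) = f x` for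
every `x` (`K g = ε ν(g) + (1 − ε) R g`, `ν(g) = π(f)/ε = 0`, `(1 − ε) R g = g − f`). -/
theorem resolvent_poisson (hπ : Kernel.Invariant κ π) (hε0 : 0 < ε) (hε : ε < 1) {f : Ω → ℝ}
    (hf : Measurable f) {C : ℝ} (hC : ∀ x, |f x| ≤ C) (hf0 : ∫ x, f x ∂π = 0) (x : Ω) :
    (∑' d, (1 - ε.toReal) ^ d * (kop (Doeblin.residualKernel κ ν ε hmin))^[d] f x)
      - kop κ (fun y => ∑' d, (1 - ε.toReal) ^ d
        * (kop (Doeblin.residualKernel κ ν ε hmin))^[d] f y) x = f x := by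
  obtain ⟨hr, -, -⟩ := one_sub_toReal_eq_of_lt_one (ε := ε) hε
  obtain ⟨hgm, hgb⟩ := resolvent_bounded_measurable (κ := κ) (ν := ν) (hmin := hmin) hε0 hε hf hC
  have hνg := integral_resolvent_eq (κ := κ) (ν := ν) (hmin := hmin) hπ hε0 hε hf hC
  rw [hf0, zero_div] at hνg
  have hres := resolvent_eq (κ := κ) (ν := ν) (hmin := hmin) hε0 hε hf hC x
  rw [kop_eq_add_residual (κ := κ) (π := ν) (hmin := hmin) hε hgm hgb x, hνg, mul_zero, zero_add, hr]
  linarith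

/-- **GREEN–KUBO WITH THE RESOLVENT**: for `π` invariant, `κ(x, ·) ≥ ε ν`, `0 < ε < 1`, `|f| ≤ C`
measurable and `π`-centred: `HasSum (t ↦ ∫ f · (kop κ)^[t] f dπ) (∫ f · g dπ)` — the sum of all
autocovariances is the `π`-inner product of `f` with its expected occupation until regeneration. -/
theorem greenKubo_hasSum_resolvent (hπ : Kernel.Invariant κ π)
    (hmin : ∀ x {B : Set Ω}, MeasurableSet B → ε * ν B ≤ κ x B) (hε0 : 0 < ε) (hε : ε < 1)
    {f : Ω → ℝ} (hf : Measurable f) {C : ℝ} (hC : ∀ x, |f x| ≤ C) (hf0 : ∫ x, f x ∂π = 0) :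
    HasSum (fun t => autocov κ π f t) (∫ x, f x * (∑' d, (1 - ε.toReal) ^ d
      * (kop (Doeblin.residualKernel κ ν ε hmin))^[d] f x) ∂π) := by
  obtain ⟨hgm, hgb⟩ := resolvent_bounded_measurable (κ := κ) (ν := ν) (hmin := hmin) hε0 hε hf hC
  exact greenKubo_hasSum_minorised (κ := κ) (ν := ν) hπ hmin hε0 hε hf hC hf0 hgm hgb
    (fun x => resolvent_poisson (κ := κ) (ν := ν) (hmin := hmin) hπ hε0 hε hf hC hf0 x)

end Resolvent

end Summit.Ventures.LatticeQCDFlow.Scoring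

end
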